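import Mathlib
import Literature.NumberTheory.Transcendental.GelfondCriterionProofs
import Literature.LinearAlgebra.Matrix.SimilitudeCharpoly

/-!
# The dilated factor `q(cT)`: degree, type, value and non-vanishing (kernel form)

Soloist file (informed mode, seat `solo-Schanuel-informed`, s179).  This is step (ii) of the
ENDGAME LEMMA of the seat's note `paper/AE-note.md` §6 in its `η = 0` form (Remark R5 there):
given an integer polynomial `q` of degree `d` with a complex root `ρ` close to a point `c ξ`
(`1 ≤ c ≤ K`, `‖ρ − c ξ‖ ≤ ε`), the DILATED polynomial `q(cT) = q.comp (C c * X) ∈ ℤ[X]` has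
degree `d`, Gel'fond type `≤ d (2 + log K) + log M(q)`, value `q(cT)|_{T = ξ} = q(c ξ)` of
modulus `≤ ε (K‖ξ‖ + 1)^d M(q)`, and this value is NON-ZERO when `ξ` is transcendental — the
data that the tree's Gel'fond criterion
(`Literature.NumberTheory.Transcendental.gelfond_criterion_not_small_values`, type
`Polynomial.gelfondType`) consumes at the single point `ξ`.

Contents (prefix `soloDF_`; the coefficient formula `(q(aT))_k = a^k q_k` and
`‖q‖_∞ = ‖q^ℂ‖_∞`, `log ‖q‖_∞ ≤ d + log M(q)` are the tree's
`Literature.LinearAlgebra.Matrix.SimilitudeCharpoly.coeff_comp_C_mul_X`,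
`Polynomial.supNorm_map_intCastRingHom`, `Polynomial.log_supNorm_le`):
* `soloDF_natDegree_comp_C_mul_X`, `soloDF_comp_C_mul_X_ne_zero`, `soloDF_aeval_comp_C_mul_X`;
* `soloDF_supNorm_comp_C_mul_X_le` — `‖q(cT)‖_∞ ≤ K^d ‖q‖_∞` for `1 ≤ c ≤ K`;
* `soloDF_gelfondType_comp_C_mul_X_le` — `t(q(cT)) ≤ d (2 + log K) + log M(q)`;
* `soloDF_norm_aeval_le` — VALUE: `‖q(c ξ)‖ ≤ ε (K‖ξ‖ + 1)^d M(q)` if `q(ρ) = 0`,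
  `‖ρ − c ξ‖ ≤ ε`, `c ≤ K`;
* `soloDF_aeval_comp_C_mul_X_ne_zero` — NON-VANISHING at a transcendental `ξ` (`c ≠ 0`);
* `soloDF_package` — the five facts packaged as `∃ Q ∈ ℤ[X], …` for the criterion at `ξ`.

What this is NOT.  One elementary input of the seat's pen-and-paper THEOREM AE-1 on the node
`RoyAdditiveDirichletExponent` ([cite: Roy2010, Thm 1.1]; small value estimates for the
additive group); the assembly (served set, Lemma AE, Theorem C, Lemma H, cheap factor, this
file, Gel'fond's criterion, asymptotics) is not in the kernel, and nothing here bears on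
`Literature.Periods.SchanuelConjecture` (the seat's verdict, no path, is unchanged).  The
mathematics is elementary and claimed by no one as new; Mathlib plus three tree files
(`GelfondCriterionProofs` for `Polynomial.gelfondType` and the height lemmas,
`SimilitudeCharpoly` for the coefficient formula); no definitions, no literature hypothesis;
axioms the standard three.
-/

namespace Summit.Schanuel.Schanuel.Theorems

open Polynomial

section Dilation

variable {R : Type*} [CommRing R]

/-- For `a ≠ 0` in a domain, `deg q(aT) = deg q`. -/
theorem soloDF_natDegree_comp_C_mul_X [IsDomain R] (q : R[X]) {a : R} (ha : a ≠ 0) :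
    (q.comp (C a * X)).natDegree = q.natDegree := by
  rw [natDegree_comp, natDegree_C_mul_X a ha, mul_one]

/-- For `a ≠ 0` in a domain and `q ≠ 0`, `q(aT) ≠ 0`. -/
theorem soloDF_comp_C_mul_X_ne_zero [IsDomain R] {q : R[X]} (hq : q ≠ 0) {a : R} (ha : a ≠ 0) :
    q.comp (C a * X) ≠ 0 := by
  intro h
  have hlc := leadingCoeff_comp (p := q) (q := C a * X)
    (by rw [natDegree_C_mul_X a ha]; exact one_ne_zero)
  rw [h, leadingCoeff_zero, leadingCoeff_C_mul_X] at hlc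
  exact (mul_ne_zero (leadingCoeff_ne_zero.mpr hq) (pow_ne_zero _ ha)) hlc.symm

/-- Value of the dilated integer polynomial: `q(cT)(ξ) = q(c ξ)`. -/
theorem soloDF_aeval_comp_C_mul_X (q : ℤ[X]) (c : ℤ) (ξ : ℂ) :
    aeval ξ (q.comp (C c * X)) = aeval ((c : ℂ) * ξ) q := by
  rw [aeval_comp]
  congr 1
  simp

end Dilation

section Height

/-- Height of the dilation: `‖q(cT)‖_∞ ≤ K^d ‖q‖_∞` for naturals `1 ≤ c ≤ K`, `d = deg q`. -/
theorem soloDF_supNorm_comp_C_mul_X_le (q : ℤ[X]) {c K : ℕ} (hc : 1 ≤ c) (hcK : c ≤ K) :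
    (q.comp (C (c : ℤ) * X)).supNorm ≤ (K : ℝ) ^ q.natDegree * q.supNorm := by
  obtain ⟨i, hi⟩ := (q.comp (C (c : ℤ) * X)).exists_eq_supNorm
  rw [hi, Literature.LinearAlgebra.Matrix.SimilitudeCharpoly.coeff_comp_C_mul_X,
    norm_mul, norm_pow, Int.norm_eq_abs, Int.cast_natCast,
    Nat.abs_cast]
  by_cases hqi : q.coeff i = 0
  · rw [hqi, norm_zero, mul_zero]
    exact mul_nonneg (pow_nonneg (Nat.cast_nonneg _) _) q.supNorm_nonneg
  · have hid : i ≤ q.natDegree := le_natDegree_of_ne_zero hqi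
    have hK1 : (1 : ℝ) ≤ K := by exact_mod_cast hc.trans hcK
    calc (c : ℝ) ^ i * ‖q.coeff i‖ ≤ (K : ℝ) ^ i * ‖q.coeff i‖ := by
          apply mul_le_mul_of_nonneg_right _ (norm_nonneg _)
          exact pow_le_pow_left₀ (Nat.cast_nonneg _) (by exact_mod_cast hcK) i
      _ ≤ (K : ℝ) ^ q.natDegree * q.supNorm :=
          mul_le_mul (pow_le_pow_right₀ hK1 hid) (q.le_supNorm i) (norm_nonneg _)
            (pow_nonneg (Nat.cast_nonneg _) _)

/-- **Type of the dilation.**  For `q ≠ 0` of degree `d` and naturals `1 ≤ c ≤ K`: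
`t(q(cT)) ≤ d (2 + log K) + log M(q)` (height of the dilation, then the tree's
`Polynomial.log_supNorm_le`: `log ‖q‖_∞ ≤ d + log M(q)`, from Mathlib's Mahler bound). -/
theorem soloDF_gelfondType_comp_C_mul_X_le (q : ℤ[X]) (hq : q ≠ 0) {c K : ℕ} (hc : 1 ≤ c)
    (hcK : c ≤ K) :
    (q.comp (C (c : ℤ) * X)).gelfondType ≤
      q.natDegree * (2 + Real.log K) + Real.log (q.map (Int.castRingHom ℂ)).mahlerMeasure := by
  have hc0 : (c : ℤ) ≠ 0 := by exact_mod_cast (Nat.one_le_iff_ne_zero.mp hc)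
  have hK0 : (0 : ℝ) < K := by exact_mod_cast hc.trans hcK
  have hq1 : 1 ≤ q.supNorm := one_le_supNorm_of_ne_zero hq
  have hQ1 : 1 ≤ (q.comp (C (c : ℤ) * X)).supNorm :=
    one_le_supNorm_of_ne_zero (soloDF_comp_C_mul_X_ne_zero hq hc0)
  unfold gelfondType
  rw [soloDF_natDegree_comp_C_mul_X q hc0]
  have hlog : Real.log (q.comp (C (c : ℤ) * X)).supNorm ≤
      q.natDegree * Real.log K + Real.log q.supNorm := by
    calc Real.log (q.comp (C (c : ℤ) * X)).supNorm
        ≤ Real.log ((K : ℝ) ^ q.natDegree * q.supNorm) :=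
          Real.log_le_log (zero_lt_one.trans_le hQ1) (soloDF_supNorm_comp_C_mul_X_le q hc hcK)
      _ = q.natDegree * Real.log K + Real.log q.supNorm := by
          rw [Real.log_mul (by positivity) (by positivity), Real.log_pow]
  have hmig := Polynomial.log_supNorm_le hq
  rw [Polynomial.logMahlerMeasure_eq_log_MahlerMeasure] at hmig
  nlinarith [hlog, hmig, Nat.cast_nonneg (α := ℝ) q.natDegree]

end Height

section Value

/-- **Value estimate.**  `q ∈ ℤ[X]` with a complex root `ρ`, `‖ρ − c ξ‖ ≤ ε` (`0 ≤ ε`), `c ≤ K`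
naturals: `‖q(c ξ)‖ ≤ ε (K‖ξ‖ + 1)^{deg q} M(q)`.  (Factor `‖c ξ − ρ‖ ≤ ε`; every other root
`r` contributes `‖c ξ − r‖ ≤ (K‖ξ‖ + 1) max 1 ‖r‖`; `M(q) = ‖lc‖ ∏ max 1 ‖r‖`.) -/
theorem soloDF_norm_aeval_le (q : ℤ[X]) (hq : q ≠ 0) {ρ ξ : ℂ} {c K : ℕ} (hcK : c ≤ K) {ε : ℝ}
    (hε : 0 ≤ ε) (hρ : aeval ρ q = 0) (hclose : ‖ρ - c * ξ‖ ≤ ε) :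
    ‖aeval ((c : ℂ) * ξ) q‖ ≤
      ε * (K * ‖ξ‖ + 1) ^ q.natDegree * (q.map (Int.castRingHom ℂ)).mahlerMeasure := by
  set qC := q.map (Int.castRingHom ℂ) with hqC
  have hqC0 : qC ≠ 0 := (Polynomial.map_ne_zero_iff Int.cast_injective).mpr hq
  have hd : qC.natDegree = q.natDegree := natDegree_map_eq_of_injective Int.cast_injective q
  have heval : aeval ((c : ℂ) * ξ) q = qC.eval ((c : ℂ) * ξ) := by
    rw [aeval_def, ← eval_map, algebraMap_int_eq]
  have hmem : ρ ∈ qC.roots := by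
    rw [mem_roots hqC0, IsRoot.def, hqC, ← algebraMap_int_eq, eval_map, ← aeval_def]
    exact hρ
  set z : ℂ := (c : ℂ) * ξ with hz
  have hzK : ‖z‖ ≤ K * ‖ξ‖ := by
    rw [hz, norm_mul, Complex.norm_natCast]
    exact mul_le_mul_of_nonneg_right (by exact_mod_cast hcK) (norm_nonneg _)
  set B : ℝ := K * ‖ξ‖ + 1 with hB
  have hB1 : 1 ≤ B := by rw [hB]; nlinarith [norm_nonneg ξ, (Nat.cast_nonneg K : (0:ℝ) ≤ K)]
  -- each root factor
  have hfac : ∀ r : ℂ, ‖z - r‖ ≤ B * max 1 ‖r‖ := by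
    intro r
    calc ‖z - r‖ ≤ ‖z‖ + ‖r‖ := norm_sub_le _ _
      _ ≤ K * ‖ξ‖ * max 1 ‖r‖ + max 1 ‖r‖ := by
          apply add_le_add
          · calc ‖z‖ ≤ K * ‖ξ‖ := hzK
              _ = K * ‖ξ‖ * 1 := (mul_one _).symm
              _ ≤ K * ‖ξ‖ * max 1 ‖r‖ :=
                mul_le_mul_of_nonneg_left (le_max_left _ _) (by positivity)
          · exact le_max_right _ _
      _ = B * max 1 ‖r‖ := by rw [hB]; ring
  -- product over the other roots
  set s := qC.roots.erase ρ with hs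
  have hroots : qC.roots = ρ ::ₘ s := (Multiset.cons_erase hmem).symm
  have hcard : Multiset.card s ≤ q.natDegree := by
    have := Polynomial.card_roots' qC
    rw [hroots, Multiset.card_cons, hd] at this
    omega
  have hprod_le : (s.map (fun r => ‖z - r‖)).prod ≤
      B ^ q.natDegree * (s.map (fun r => max 1 ‖r‖)).prod := by
    calc (s.map (fun r => ‖z - r‖)).prod ≤ (s.map (fun r => B * max 1 ‖r‖)).prod :=
          Multiset.prod_map_le_prod_map₀ _ _ (fun _ _ => norm_nonneg _) (fun r _ => hfac r)
      _ = B ^ Multiset.card s * (s.map (fun r => max 1 ‖r‖)).prod := by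
          rw [Multiset.prod_map_mul, Multiset.map_const', Multiset.prod_replicate]
      _ ≤ B ^ q.natDegree * (s.map (fun r => max 1 ‖r‖)).prod := by
          apply mul_le_mul_of_nonneg_right (pow_le_pow_right₀ hB1 hcard)
          exact Multiset.prod_nonneg (fun x hx => by
            obtain ⟨r, _, rfl⟩ := Multiset.mem_map.mp hx
            exact le_trans zero_le_one (le_max_left _ _))
  have hmax1 : (s.map (fun r => max 1 ‖r‖)).prod ≤ (qC.roots.map (fun r => max 1 ‖r‖)).prod := by
    rw [hroots, Multiset.map_cons, Multiset.prod_cons]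
    apply le_mul_of_one_le_left _ (le_max_left _ _)
    exact Multiset.prod_nonneg (fun x hx => by
      obtain ⟨r, _, rfl⟩ := Multiset.mem_map.mp hx
      exact le_trans zero_le_one (le_max_left _ _))
  -- assemble
  have hnorm : ‖(s.map (fun x => z - x)).prod‖ = (s.map (fun r => ‖z - r‖)).prod := by
    have h := map_multiset_prod (normHom : ℂ →*₀ ℝ) (s.map (fun x => z - x))
    simpa [Multiset.map_map, Function.comp_def] using h
  have hB0 : (0 : ℝ) ≤ B ^ q.natDegree := pow_nonneg (zero_le_one.trans hB1) _
  have hs0 : 0 ≤ (s.map (fun r => ‖z - r‖)).prod := Multiset.prod_nonneg (fun x hx => by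
    obtain ⟨r, _, rfl⟩ := Multiset.mem_map.mp hx
    exact norm_nonneg _)
  rw [heval, (IsAlgClosed.splits qC).eval_eq_prod_roots z, norm_mul, hroots, Multiset.map_cons,
    Multiset.prod_cons, norm_mul, hnorm, norm_sub_rev z ρ,
    mahlerMeasure_eq_leadingCoeff_mul_prod_roots]
  calc ‖qC.leadingCoeff‖ * (‖ρ - z‖ * (s.map (fun r => ‖z - r‖)).prod)
      ≤ ‖qC.leadingCoeff‖ * (ε * (B ^ q.natDegree * (s.map (fun r => max 1 ‖r‖)).prod)) :=
        mul_le_mul_of_nonneg_left (mul_le_mul hclose hprod_le hs0 hε) (norm_nonneg _)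
    _ ≤ ‖qC.leadingCoeff‖ *
          (ε * (B ^ q.natDegree * (qC.roots.map (fun r => max 1 ‖r‖)).prod)) :=
        mul_le_mul_of_nonneg_left (mul_le_mul_of_nonneg_left
          (mul_le_mul_of_nonneg_left hmax1 hB0) hε) (norm_nonneg _)
    _ = ε * B ^ q.natDegree *
          (‖qC.leadingCoeff‖ * (qC.roots.map (fun r => max 1 ‖r‖)).prod) := by ring

end Value

section Package

/-- **Non-vanishing.**  For `ξ` transcendental over `ℚ`, `q ≠ 0` in `ℤ[X]` and `c ≠ 0`:
`q(cT)(ξ) ≠ 0` (else the non-zero integer polynomial `q(cT)` would make `ξ` algebraic). -/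
theorem soloDF_aeval_comp_C_mul_X_ne_zero {ξ : ℂ} (hξ : Transcendental ℚ ξ) {q : ℤ[X]}
    (hq : q ≠ 0) {c : ℤ} (hc : c ≠ 0) : aeval ξ (q.comp (C c * X)) ≠ 0 := by
  intro h
  apply hξ
  refine ⟨(q.comp (C c * X)).map (algebraMap ℤ ℚ), ?_, ?_⟩
  · exact (Polynomial.map_ne_zero_iff (algebraMap ℤ ℚ).injective_int).mpr
      (soloDF_comp_C_mul_X_ne_zero hq hc)
  · rw [aeval_map_algebraMap]
    exact h

/-- **The dilated factor, packaged as an input for Gel'fond's criterion at the point `ξ`.**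
Let `ξ` be transcendental, `q ≠ 0` in `ℤ[X]` of degree `d` with a complex root `ρ`, and let
`1 ≤ c ≤ K` be naturals with `‖ρ − c ξ‖ ≤ ε` (`0 ≤ ε`).  Then there is `Q ∈ ℤ[X]` (namely
`Q = q(cT)`) with `Q ≠ 0`, `deg Q = d`, Gel'fond type
`t(Q) ≤ d (2 + log K) + log M(q)`, and a NON-ZERO value at `ξ` of modulus
`‖Q(ξ)‖ ≤ ε (K‖ξ‖ + 1)^d M(q)`. -/
theorem soloDF_package {ξ : ℂ} (hξ : Transcendental ℚ ξ) (q : ℤ[X]) (hq : q ≠ 0) {ρ : ℂ}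
    (hρ : aeval ρ q = 0) {c K : ℕ} (hc : 1 ≤ c) (hcK : c ≤ K) {ε : ℝ} (hε : 0 ≤ ε)
    (hclose : ‖ρ - c * ξ‖ ≤ ε) :
    ∃ Q : ℤ[X], Q ≠ 0 ∧ Q.natDegree = q.natDegree ∧
      Q.gelfondType ≤ q.natDegree * (2 + Real.log K) +
        Real.log (q.map (Int.castRingHom ℂ)).mahlerMeasure ∧
      aeval ξ Q ≠ 0 ∧
      ‖aeval ξ Q‖ ≤
        ε * (K * ‖ξ‖ + 1) ^ q.natDegree * (q.map (Int.castRingHom ℂ)).mahlerMeasure := by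
  have hc0 : (c : ℤ) ≠ 0 := by exact_mod_cast Nat.one_le_iff_ne_zero.mp hc
  refine ⟨q.comp (C (c : ℤ) * X), soloDF_comp_C_mul_X_ne_zero hq hc0,
    soloDF_natDegree_comp_C_mul_X q hc0, soloDF_gelfondType_comp_C_mul_X_le q hq hc hcK,
    soloDF_aeval_comp_C_mul_X_ne_zero hξ hq hc0, ?_⟩
  rw [soloDF_aeval_comp_C_mul_X]
  push_cast
  exact soloDF_norm_aeval_le q hq hcK hε hρ hclose

end Package

end Summit.Schanuel.Schanuel.Theorems
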